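import Summits.Parity.GeneralizedHardyLittlewood.Theorems.FordMaynardNoSieveConst0164NegWitness0164CellTable

/-!
# Route `FordMaynardNoSieveConst0164`, crux `NegWitness0164` (stmt-Parity-19102), line `birth`,
# stub `stub_tweakNeg0164`: the table integrals of (I) and (II) as linear combinations of cell integrals

Helper file toward the certificate stub (K. Ford, J. Maynard, *On the theory of prime producing sieves*,
arXiv:2407.14368, §8; CERT-FORMAT.md §1 (F2), (F4): "a finite sum over cell multisets of `F₀[μ]·D(μ; α)`").  For the
cell step table `G⁽⁵⁾ = Σ_t c(t) 𝟙[cell t ∩ {Σ = 1}]` of `stub_tweakNeg0164_of_cellTable` (`…CellTable`), the two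
integrals containing `G⁽⁵⁾` are finite linear combinations of PARAMETER-FREE cell integrals:

* `table_integral_five_eq_sum_0164` — `∫_{Δ₅(1)} 𝟙[v ≥ ν] G⁽⁵⁾(v)/∏v = Σ_t c(t) · ∫_{Δ₅(1)} 𝟙[v ∈ cell t]/∏v`
  (inequality (I));
* `table_integral_three_eq_sum_0164` — for `b ∈ ℝ²` and `α = 1 − |b|`:
  `∫_{Δ₃(α)} 𝟙[v ≥ ν] G⁽⁵⁾(v, b)/(v₀v₁v₂) = Σ_t c(t) · ∫_{Δ₃(α)} 𝟙[(v, b) ∈ cell t]/(v₀v₁v₂)` (inequality (II); the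
  indicator factors as `𝟙[b ∈ cells (t₃, t₄)] · 𝟙[v ∈ cells (t₀, t₁, t₂)]`, so for `b` in a fixed cell pair this is a
  one-parameter family in `α`, CERT-FORMAT's 73 families).

Def-free.  References: [FordMaynard2024PrimeSieves] arXiv:2407.14368, §8; cell certificate format of the decomposition cell.
-/

noncomputable section

open Finset MeasureTheory Set
open scoped Classical
open Literature.NumberTheory.Sieve Literature.NumberTheory.Sieve.FordMaynard

namespace Summit.Parity.GeneralizedHardyLittlewood.FordMaynardNoSieveConst0164NegWitness0164

/-- A cell box of the `ν = 41/250`, `w = 7/500` grid is measurable. [folklore] -/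
theorem measurableSet_cellBox_0164 {k : ℕ} (t : Fin k → Fin 24) :
    MeasurableSet {x : Fin k → ℝ | ∀ i, (41 / 250 + (t i : ℕ) * (7 / 500) : ℝ) ≤ x i ∧
      x i < 41 / 250 + ((t i : ℕ) + 1) * (7 / 500)} := by
  have h : {x : Fin k → ℝ | ∀ i, (41 / 250 + (t i : ℕ) * (7 / 500) : ℝ) ≤ x i ∧
      x i < 41 / 250 + ((t i : ℕ) + 1) * (7 / 500)} =
      ⋂ i, ({x : Fin k → ℝ | (41 / 250 + (t i : ℕ) * (7 / 500) : ℝ) ≤ x i} ∩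
        {x : Fin k → ℝ | x i < (41 / 250 + ((t i : ℕ) + 1) * (7 / 500) : ℝ)}) := by
    ext x; simp
  rw [h]
  exact MeasurableSet.iInter fun i => (measurableSet_le measurable_const (measurable_pi_apply i)).inter
    (measurableSet_lt (measurable_pi_apply i) measurable_const)

/-- **(I): the table integral over `Δ₅(1)` is a linear combination of cell integrals.**
[cite: FordMaynard2024PrimeSieves, §8 (I₅ as a sum over the pieces of f_{5,0})] -/
theorem table_integral_five_eq_sum_0164 (c : (Fin 5 → Fin 24) → ℝ) :
    sliceIntegral 5 1 (fun v => if ∀ t, (41 / 250 : ℝ) ≤ v t then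
        (∑ t : Fin 5 → Fin 24, (if (∀ i, (41 / 250 + (t i : ℕ) * (7 / 500) : ℝ) ≤ v i ∧
            v i < 41 / 250 + ((t i : ℕ) + 1) * (7 / 500)) ∧ ∑ i, v i = 1 then c t else 0)) /
          (v 0 * v 1 * v 2 * v 3 * v 4) else 0) =
      ∑ t : Fin 5 → Fin 24, c t * sliceIntegral 5 1 (fun v =>
        if ∀ i, (41 / 250 + (t i : ℕ) * (7 / 500) : ℝ) ≤ v i ∧ v i < 41 / 250 + ((t i : ℕ) + 1) * (7 / 500) then
          1 / (v 0 * v 1 * v 2 * v 3 * v 4) else 0) := by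
  -- pointwise on the slice: the outer indicator and `Σ v = 1` are implied by cell membership
  have hpt : ∀ v : Fin 5 → ℝ, (∀ i, 0 < v i) → ∑ i, v i = 1 →
      (if ∀ t, (41 / 250 : ℝ) ≤ v t then
        (∑ t : Fin 5 → Fin 24, (if (∀ i, (41 / 250 + (t i : ℕ) * (7 / 500) : ℝ) ≤ v i ∧
            v i < 41 / 250 + ((t i : ℕ) + 1) * (7 / 500)) ∧ ∑ i, v i = 1 then c t else 0)) /
          (v 0 * v 1 * v 2 * v 3 * v 4) else 0) =
      ∑ t : Fin 5 → Fin 24, c t * (if ∀ i, (41 / 250 + (t i : ℕ) * (7 / 500) : ℝ) ≤ v i ∧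
          v i < 41 / 250 + ((t i : ℕ) + 1) * (7 / 500) then 1 / (v 0 * v 1 * v 2 * v 3 * v 4) else 0) := by
    intro v hv hvs
    by_cases hν : ∀ t, (41 / 250 : ℝ) ≤ v t
    · rw [if_pos hν, Finset.sum_div]
      refine Finset.sum_congr rfl fun t _ => ?_
      by_cases hc : ∀ i, (41 / 250 + (t i : ℕ) * (7 / 500) : ℝ) ≤ v i ∧ v i < 41 / 250 + ((t i : ℕ) + 1) * (7 / 500)
      · rw [if_pos ⟨hc, hvs⟩, if_pos hc]; ring
      · rw [if_neg (fun h => hc h.1), if_neg hc]; ring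
    · rw [if_neg hν]
      symm
      refine Finset.sum_eq_zero fun t _ => ?_
      rw [if_neg, mul_zero]
      intro hc
      apply hν
      intro i
      have := (hc i).1
      have h0 : (0 : ℝ) ≤ (t i : ℕ) * (7 / 500) := by positivity
      linarith
  rw [sliceIntegral_congr hpt]
  rw [sliceIntegral_finset_sum Finset.univ 5 1 (fun t v => c t *
      (if ∀ i, (41 / 250 + (t i : ℕ) * (7 / 500) : ℝ) ≤ v i ∧ v i < 41 / 250 + ((t i : ℕ) + 1) * (7 / 500) then
        1 / (v 0 * v 1 * v 2 * v 3 * v 4) else 0))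
    (fun t => measurable_const.mul (Measurable.ite (measurableSet_cellBox_0164 t)
      (measurable_const.div ((((measurable_pi_apply 0).mul (measurable_pi_apply 1)).mul
        (measurable_pi_apply 2)).mul (measurable_pi_apply 3) |>.mul (measurable_pi_apply 4))) measurable_const))
    (C := (∑ t : Fin 5 → Fin 24, |c t|) * (250 / 41) ^ 5) (fun t v => ?_)]
  · exact Finset.sum_congr rfl fun t _ => sliceIntegral_const_mul _ _ _
  · rw [abs_mul]
    have hct : |c t| ≤ ∑ t' : Fin 5 → Fin 24, |c t'| :=
      Finset.single_le_sum (f := fun t' => |c t'|) (fun t' _ => abs_nonneg _) (Finset.mem_univ t)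
    refine mul_le_mul hct ?_ (abs_nonneg _) (Finset.sum_nonneg fun t' _ => abs_nonneg _)
    split_ifs with h
    · have hge : ∀ i, (41 / 250 : ℝ) ≤ v i := fun i => by
        have := (h i).1
        have h0 : (0 : ℝ) ≤ (t i : ℕ) * (7 / 500) := by positivity
        linarith
      have h0 := hge 0; have h1 := hge 1; have h2 := hge 2; have h3 := hge 3; have h4 := hge 4
      have hp : 0 < v 0 * v 1 * v 2 * v 3 * v 4 := by
        have : (0:ℝ) < 41 / 250 := by norm_num
        have := this.trans_le h0; have := ‹(0:ℝ) < 41/250›.trans_le h1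
        positivity
      rw [abs_of_pos (by positivity), div_le_iff₀ hp]
      have h01 : (41 / 250 : ℝ) ^ 2 ≤ v 0 * v 1 := by nlinarith
      have h012 : (41 / 250 : ℝ) ^ 3 ≤ v 0 * v 1 * v 2 := by nlinarith
      have h0123 : (41 / 250 : ℝ) ^ 4 ≤ v 0 * v 1 * v 2 * v 3 := by nlinarith
      have h01234 : (41 / 250 : ℝ) ^ 5 ≤ v 0 * v 1 * v 2 * v 3 * v 4 := by nlinarith
      nlinarith
    · rw [abs_zero]; positivity

/-- **(II): the table integral over `Δ₃(α)` at `b` is a linear combination of cell integrals.**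
[cite: FordMaynard2024PrimeSieves, §8 (F₅(β₁,β₂) as a sum over the pieces of f_{5,0})] -/
theorem table_integral_three_eq_sum_0164 (c : (Fin 5 → Fin 24) → ℝ) (b : Fin 2 → ℝ) :
    sliceIntegral 3 (1 - ∑ i, b i) (fun v => if ∀ t, (41 / 250 : ℝ) ≤ v t then
        (∑ t : Fin 5 → Fin 24, (if (∀ i, (41 / 250 + (t i : ℕ) * (7 / 500) : ℝ) ≤ (Fin.append v b) i ∧
            (Fin.append v b) i < 41 / 250 + ((t i : ℕ) + 1) * (7 / 500)) ∧ ∑ i, (Fin.append v b) i = 1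
            then c t else 0)) / (v 0 * v 1 * v 2) else 0) =
      ∑ t : Fin 5 → Fin 24, c t * sliceIntegral 3 (1 - ∑ i, b i) (fun v =>
        if ∀ i, (41 / 250 + (t i : ℕ) * (7 / 500) : ℝ) ≤ (Fin.append v b) i ∧
          (Fin.append v b) i < 41 / 250 + ((t i : ℕ) + 1) * (7 / 500) then 1 / (v 0 * v 1 * v 2) else 0) := by
  have hsum : ∀ v : Fin 3 → ℝ, ∑ i, (Fin.append v b) i = (∑ i, v i) + ∑ i, b i := fun v => by
    rw [Fin.sum_univ_add]
    simp only [Fin.append_left, Fin.append_right]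
  have hpt : ∀ v : Fin 3 → ℝ, (∀ i, 0 < v i) → ∑ i, v i = 1 - ∑ i, b i →
      (if ∀ t, (41 / 250 : ℝ) ≤ v t then
        (∑ t : Fin 5 → Fin 24, (if (∀ i, (41 / 250 + (t i : ℕ) * (7 / 500) : ℝ) ≤ (Fin.append v b) i ∧
            (Fin.append v b) i < 41 / 250 + ((t i : ℕ) + 1) * (7 / 500)) ∧ ∑ i, (Fin.append v b) i = 1
            then c t else 0)) / (v 0 * v 1 * v 2) else 0) =
      ∑ t : Fin 5 → Fin 24, c t * (if ∀ i, (41 / 250 + (t i : ℕ) * (7 / 500) : ℝ) ≤ (Fin.append v b) i ∧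
          (Fin.append v b) i < 41 / 250 + ((t i : ℕ) + 1) * (7 / 500) then 1 / (v 0 * v 1 * v 2) else 0) := by
    intro v hv hvs
    have hs1 : ∑ i, (Fin.append v b) i = 1 := by rw [hsum, hvs]; ring
    by_cases hν : ∀ t, (41 / 250 : ℝ) ≤ v t
    · rw [if_pos hν, Finset.sum_div]
      refine Finset.sum_congr rfl fun t _ => ?_
      by_cases hc : ∀ i, (41 / 250 + (t i : ℕ) * (7 / 500) : ℝ) ≤ (Fin.append v b) i ∧
          (Fin.append v b) i < 41 / 250 + ((t i : ℕ) + 1) * (7 / 500)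
      · rw [if_pos ⟨hc, hs1⟩, if_pos hc]; ring
      · rw [if_neg (fun h => hc h.1), if_neg hc]; ring
    · rw [if_neg hν]
      symm
      refine Finset.sum_eq_zero fun t _ => ?_
      rw [if_neg, mul_zero]
      intro hc
      apply hν
      intro i
      have := (hc (Fin.castAdd 2 i)).1
      rw [Fin.append_left] at this
      have h0 : (0 : ℝ) ≤ (t (Fin.castAdd 2 i) : ℕ) * (7 / 500) := by positivity
      linarith
  rw [sliceIntegral_congr hpt]
  have hmeas : ∀ t : Fin 5 → Fin 24, Measurable (fun v : Fin 3 → ℝ => c t *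
      (if ∀ i, (41 / 250 + (t i : ℕ) * (7 / 500) : ℝ) ≤ (Fin.append v b) i ∧
          (Fin.append v b) i < 41 / 250 + ((t i : ℕ) + 1) * (7 / 500) then 1 / (v 0 * v 1 * v 2) else 0)) := by
    intro t
    refine measurable_const.mul (Measurable.ite ?_ (measurable_const.div (((measurable_pi_apply 0).mul
      (measurable_pi_apply 1)).mul (measurable_pi_apply 2))) measurable_const)
    exact (measurableSet_cellBox_0164 t).preimage (measurable_append_left b)
  rw [sliceIntegral_finset_sum Finset.univ 3 (1 - ∑ i, b i) _ hmeas
    (C := (∑ t : Fin 5 → Fin 24, |c t|) * (250 / 41) ^ 3) (fun t v => ?_)]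
  · exact Finset.sum_congr rfl fun t _ => sliceIntegral_const_mul _ _ _
  · rw [abs_mul]
    have hct : |c t| ≤ ∑ t' : Fin 5 → Fin 24, |c t'| :=
      Finset.single_le_sum (f := fun t' => |c t'|) (fun t' _ => abs_nonneg _) (Finset.mem_univ t)
    refine mul_le_mul hct ?_ (abs_nonneg _) (Finset.sum_nonneg fun t' _ => abs_nonneg _)
    split_ifs with h
    · have hge : ∀ i : Fin 3, (41 / 250 : ℝ) ≤ v i := fun i => by
        have := (h (Fin.castAdd 2 i)).1
        rw [Fin.append_left] at this
        have h0 : (0 : ℝ) ≤ (t (Fin.castAdd 2 i) : ℕ) * (7 / 500) := by positivity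
        linarith
      have h0 := hge 0; have h1 := hge 1; have h2 := hge 2
      have hp : 0 < v 0 * v 1 * v 2 := by
        have hn : (0:ℝ) < 41 / 250 := by norm_num
        have := hn.trans_le h0; have := hn.trans_le h1; have := hn.trans_le h2
        positivity
      rw [abs_of_pos (by positivity), div_le_iff₀ hp]
      have h01 : (41 / 250 : ℝ) ^ 2 ≤ v 0 * v 1 := by nlinarith
      have h012 : (41 / 250 : ℝ) ^ 3 ≤ v 0 * v 1 * v 2 := by nlinarith
      nlinarith
    · rw [abs_zero]; positivity

end Summit.Parity.GeneralizedHardyLittlewood.FordMaynardNoSieveConst0164NegWitness0164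

end
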